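import Literature.NumberTheory.ConnesConsani2021.ArchDensityRegularityCore
import Literature.NumberTheory.ConnesConsani2021.ProlateProjectionsProofs
import HarnessLib

/-!
# Connes–Consani 2021, §5: `ε ∘ exp` is `C²` on `[0,∞)` with a `C²` extension to `ℝ`, Lemma 5.4,
# Prop. 5.3 and Rem. 5.6 — modulo exactly ONE printed input, (rapid-decay) (PROVED otherwise)

RH-FREE corpus literature (label, line 1): bookkeeping corollaries; nothing in this file mentions
`ζ`, the critical strip or RH, and nothing here bears on the truth of RH.  bears_on (cell rh-crit,
corpus C1): apex input (B) «density of `E`» — route «ConnesConsaniSemilocal» items K0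
`DensityRegular` (stmt 19307) and the analytic half of K2 `DensitySlope` (stmt 19308).

Source: A. Connes, C. Consani, *Weil positivity and trace formula, the archimedean place*, Selecta
Math. (N.S.) 27 (2021) 77 = arXiv:2006.13771 [bib `ConnesConsani2021`], §4 p. 16 (rapid-decay):
"`λ(n) ≤ 2^{2n}π^{2n+½}((2n)!)²/((4n)!Γ(2n+3/2))` (see [Rokhlin], Theorem 14)", Prop. 5.3 / Lemma
5.4 / Rem. 5.6 (§5 pp. 32–34) and App. F.

What is here: the capstones of `ArchDensityRegularityCore.lean` (`…_of_sec4`, hypotheses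
`CC2021_sec4_cosalphan`, `CC2021_sec4_lambda_basic`, `CC2021_sec4_rapidDecay`) with the two §4
facts that ARE theorems of the tree plugged in — (cosalphan) `CC2021_sec4_cosalphan_holds` and
`|λ(n)| < 1` `abs_prolateEigen_lt_one` (seat t3, `ProlateProjectionsProofs.lean`) — so that the
ONLY remaining hypothesis is clause 1 of (rapid-decay), `∀ n, |λ(n)| ≤ rokhlinXiaoBound n`
(weaker than the named fact `CC2021_sec4_rapidDecay`, whose clause 2 is an asymptotic not used):
* `exists_isAppFDatum_prolateFun_of_rapidDecay` — the §4-only App. F datum of THE prolate vectors;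
* `exists_contDiff_isArchDensity_of_rapidDecay` — **K0**: `∃ G : ℝ → ℂ, ContDiff ℝ 2 G ∧
  IsArchDensity G` (and `G = ε∘exp` on `[0,∞)`, `G′(0) = Σ' t(n)`, `G″(0) = 0`);
* `CC2021_lemma_5_4_of_rapidDecay`, `CC2021_prop_5_3_of_rapidDecay`, `CC2021_rem_5_6_of_rapidDecay`
  — the §5 file's named facts.

WHAT THIS IS NOT: no discharge of (rapid-decay) ([Rokhlin–Xiao 2007, Thm 14]); no numerical value
of `ε′(1⁺)`; no statement about `ζ` or RH.
-/

noncomputable section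

open Real MeasureTheory Set Filter

namespace Literature.NumberTheory.ConnesConsani2021

open Literature.NumberTheory.LFunctions

/-- **The §4-only App. F datum of THE prolate vectors from (rapid-decay) clause 1 alone**
((cosalphan) and `|λ(n)| < 1` being the tree theorems `CC2021_sec4_cosalphan_holds`,
`abs_prolateEigen_lt_one`).
[cite: ConnesConsani2021, §4 p. 16 eq. (rapid-decay) (arXiv chunk p0016:L36); Prop. 4.5 (i) (arXiv item 25)] -/
theorem exists_isAppFDatum_prolateFun_of_rapidDecay
    (hrapid : ∀ n : ℕ, |prolateEigen n| ≤ rokhlinXiaoBound n) (n : ℕ) :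
    ∃ χ : ℝ, IsAppFDatum n (prolateFun n) (prolateEigen n) χ := by
  have hψ := isProlateFunction_prolateFun n
  obtain ⟨χ, hχ⟩ := hψ.eigen
  refine ⟨χ, ?_⟩
  have hψc : ContinuousOn (prolateFun n) (Icc (-1) 1) := by
    simpa using hψ.contDiffOn.continuousOn
  exact
    { isProlate := hψ
      eigen := hχ
      cosTransform_eq := fun x hx ↦ by
        rw [cosTransform_eq_re_fourier hψc, CC2021_sec4_cosalphan_holds n x hx,
          Complex.re_ofReal_mul, Complex.ofReal_re]
      sq_lam_lt := by
        have h1 := abs_prolateEigen_lt_one n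
        have h0 := abs_nonneg (prolateEigen n)
        nlinarith [sq_abs (prolateEigen n)]
      abs_lam_le := by
        have h := hrapid n
        rw [rokhlinXiaoBound] at h
        convert h using 1
        ring }

/-- **K0 `DensityRegular` modulo (rapid-decay) clause 1 ONLY**: there is a `C²` function on `ℝ`
agreeing with `ε ∘ exp` on `[0,∞)` — an archimedean density —, with slope `Σ' t(n)` and vanishing
second derivative at `0`.
[cite: ConnesConsani2021, Prop. 5.3 §5 p. 32 (arXiv item Prop. 30); Lemma 5.4 pp. 32–33; App. F Lemma F.1 (arXiv Lemma 49), arXiv PDF pp. 54–55] -/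
theorem exists_contDiff_isArchDensity_of_rapidDecay
    (hrapid : ∀ n : ℕ, |prolateEigen n| ≤ rokhlinXiaoBound n) :
    ∃ G : ℝ → ℂ, ContDiff ℝ 2 G ∧ IsArchDensity G ∧ EqOn G (epsDensity prolateFun) (Ici 0) ∧
      deriv G 0 = ((∑' n, epsSlopeTerm (prolateFun n) : ℝ) : ℂ) ∧ deriv (deriv G) 0 = 0 := by
  choose χ hχ using exists_isAppFDatum_prolateFun_of_rapidDecay hrapid
  exact exists_contDiff_isArchDensity_of_core hχ

/-- **Lemma 5.4 (`CC2021_lemma_5_4`) modulo (rapid-decay) clause 1 only.**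
[cite: ConnesConsani2021, Lemma 5.4 §5 pp. 32–33 (arXiv item Lemma 31, chunk p0020:L86–L101)] -/
theorem CC2021_lemma_5_4_of_rapidDecay
    (hrapid : ∀ n : ℕ, |prolateEigen n| ≤ rokhlinXiaoBound n) : CC2021_lemma_5_4 := by
  choose χ hχ using exists_isAppFDatum_prolateFun_of_rapidDecay hrapid
  exact CC2021_lemma_5_4_of_core hχ

/-- **Prop. 5.3 (`CC2021_prop_5_3`) modulo (rapid-decay) clause 1 only.**
[cite: ConnesConsani2021, Prop. 5.3 eqs. (97)–(98) §5 p. 32 (arXiv item Prop. 30, chunk p0020:L59–L67)] -/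
theorem CC2021_prop_5_3_of_rapidDecay
    (hrapid : ∀ n : ℕ, |prolateEigen n| ≤ rokhlinXiaoBound n) : CC2021_prop_5_3 := by
  choose χ hχ using exists_isAppFDatum_prolateFun_of_rapidDecay hrapid
  exact CC2021_prop_5_3_of_core hχ

/-- **Rem. 5.6 (`CC2021_rem_5_6`) modulo (rapid-decay) clause 1 only.**
[cite: ConnesConsani2021, Rem. 5.6 §5 p. 34 (arXiv item Rem. 33, chunk p0021:L10)] -/
theorem CC2021_rem_5_6_of_rapidDecay
    (hrapid : ∀ n : ℕ, |prolateEigen n| ≤ rokhlinXiaoBound n) : CC2021_rem_5_6 := by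
  choose χ hχ using exists_isAppFDatum_prolateFun_of_rapidDecay hrapid
  exact CC2021_rem_5_6_of_core hχ

/-- The named-fact form: all four from `CC2021_sec4_rapidDecay` (its clause 1).
[cite: ConnesConsani2021, §4 p. 16 eq. (rapid-decay) (arXiv chunk p0016:L36); §5 pp. 32–34] -/
theorem archDensity_package_of_sec4_rapidDecay (hrapid : CC2021_sec4_rapidDecay) :
    (∃ G : ℝ → ℂ, ContDiff ℝ 2 G ∧ IsArchDensity G) ∧
      CC2021_lemma_5_4 ∧ CC2021_prop_5_3 ∧ CC2021_rem_5_6 := by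
  obtain ⟨G, hG, hGa, -⟩ := exists_contDiff_isArchDensity_of_rapidDecay hrapid.1
  exact ⟨⟨G, hG, hGa⟩, CC2021_lemma_5_4_of_rapidDecay hrapid.1,
    CC2021_prop_5_3_of_rapidDecay hrapid.1, CC2021_rem_5_6_of_rapidDecay hrapid.1⟩

end Literature.NumberTheory.ConnesConsani2021

end
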